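import Mathlib
import HarnessLib
import HarnessLib.Audit
import Summits.PneNP.Statement
import Literature.Computability.MetaComplexity.ACRearrangement
import Literature.Computability.MetaComplexity.ACRearrangementCensus
import Literature.Computability.MetaComplexity.PermutationParityTautologies

/-!
Route: FregeLinesACUniverse

DORMANT since 2026-09-04T01:44:37Z (reconciler: no traction for 5 d (last activity statement-attached at 2026-08-30T01:11:25Z); parked, not closed — `ledger route dormant route-PneNP-FregeLinesACUniverse --off` to reactivate) — unstaffed, not closed; items shared with open routes are served there. `ledger route dormant <id> --off` reactivates.

# Route FregeLinesACUniverse — Superlinearly many Frege LINES from the associative–commutative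
rearrangement universe (first rung of the EF ladder)

It suffices to show X = X1 ∧ X2 together with the declared residual R1 and the hub's shared residual
R2. X1 (ACRearrangementLowerBound, rank 2, deciding): some permutations π of N = n + 1 leaves have
AC-rearrangement universe U_AC(π) = Ω(N log N) — the least number of distinct terms of a derivation,
in the pure associative–commutative calculus, re-bracketing x₀+(x₁+(⋯+x_n)) into the order π
(`ACRewriting.acUniverse`, Krajíček's measure ℓ / provability-within-a-set ⊢_Γ for the AC calculus;
semantically a set-union straight-line program). X2 (BAACBridge, rank 3): for every Frege system, a
k-line proof of the linear-size permutation-parity tautology `tauPerm π` yields a closing AC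
universe of size O(k + N) — Boolean reasoning cannot shortcut pure AC re-bracketing on this family
by more than a constant factor. The PROVED seam (inside `closes`) gives the target T
(FregeLinesSuperlinear): no Frege system proves every tautology in O(|φ|) lines — the first open
rung on the Frege/EF axis (Bonet–Buss 1993, Buss 1995, Krajíček 1995 §4.4/§13.3, Pudlák 2008 Problem
1). R1 (LinesToEFLadder, DECLARED RESIDUAL): T → EF is not polynomially bounded (the rest of the EF
ladder, = the shared hub item EFLowerBound's text). R2 (CollapseReachesEF, the EXISTING shared
residual stmt-PneNP-17354 of route-PneNP-FeasibleWitnessing): ¬PneNP → some Frege system has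
p-bounded EF. A FRONTIER ladder route: what it can settle is T (referee-grade) or the death of the
AC road (¬X1 / ¬X2), never distance-to-summit.
Lean: `(∃ C : ℕ, ∀ᶠ n : ℕ in Filter.atTop, ∃ π : Equiv.Perm (Fin (n + 1)), (n + 1) * Nat.log 2 (n +
1) ≤ C * Literature.Computability.MetaComplexity.ACRewriting.acUniverse π) ∧ (∀ F :
Literature.Computability.MetaComplexity.FregeSystem, Literature.Computability.MetaComplexity.IsFrege
F → ∃ C : ℕ, ∀ (n : ℕ) (π : Equiv.Perm (Fin (n + 1))) (p : List
(Literature.Computability.Complexity.PropForm ℕ)), F.IsProofOf p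
(Literature.Computability.MetaComplexity.PermutationParity.tauPerm π) → ∃ Δ : Finset (FreeAddMagma
(Fin (n + 1))), Literature.Computability.MetaComplexity.ACRewriting.Closes Δ
(Literature.Computability.MetaComplexity.ACRewriting.combPerm 1)
(Literature.Computability.MetaComplexity.ACRewriting.combPerm π) ∧ Δ.card ≤ C *
(Literature.Computability.MetaComplexity.proofLines p + (n + 1)))`

## Assembly
Pure logic plus the proved seam. `closes (h₁ : ACRearrangementLowerBound) (h₂ : BAACBridge) (h₃ :
LinesToEFLadder) (h₄ : CollapseReachesEF) : PneNP`: by contradiction, ¬PneNP and h₄ give a Frege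
system F with p-bounded EF; the seam proves T = FregeLinesSuperlinear from h₁, h₂ (fix a Frege
system G and a putative line constant C₀; X2 gives C₂, X1 gives C₁ and, for all large n, a
permutation π with (n+1)·log₂(n+1) ≤ C₁·U_AC(π) ≤ C₁·|Δ| ≤ C₁C₂(proofLines p + n + 1) ≤
C₁C₂(68C₀+1)(n+1) using the landed `isTautology_tauPerm`, `size_tauPerm` (= 52(n+1)+16) and
`acUniverse_le_card`; at n + 1 = 2^(N₀+K+1) this contradicts Nat.log_pow); then h₃ T F hF
contradicts F's p-bounded EF. The last step is literally route-PneNP-FeasibleWitnessing's `closes`.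
All four binders are load-bearing; the Assembly item is the same frame stated as one Prop and is
proved as a `have` inside `closes`.

Rationale: WHY THIS LINE. The mechanism is Krajíček's universe measure (ℓ = number of distinct subformulas;
provability within a set Γ, Krajicek1995 Def 4.4.3 / 13.3.1, Thm 13.3.6: ℓ_F is linear in the number
of LINES for dag-like Frege and is characterised by Boolean valuations into partial Boolean algebras
— "no nontrivial lower bounds are known for these two measures", p. 248) specialised to the pure AC
equational calculus, where a subterm-closed universe is a set-union straight-line program and
superlinear monotone technology exists (Boolean sums: Wegener/Mehlhorn; offline BST / Wilber-type
Θ(n log n) bounds, arXiv:1912.02858). The hard family is Orevkov's / Pudlák–Buss's permutation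
tautologies (PudlakBuss1995 §4: ε·n·log n tree-like steps by skeleton counting, O(n) dag-like for ∧
via projections) made PARITY and extension-encoded with Tseitin gate variables (Tseitin1968) so that
the formula has linear size (52N + 16, landed) and the projection shortcut disappears; the lower
bound is split into a pure set-system statement X1 and a conservativity statement X2, and the seam
X1 → X2 → T is proved in `closes` (Nat.log arithmetic over the landed `isTautology_tauPerm` /
`size_tauPerm`). Imported areas: term rewriting modulo AC (FreeAddMagma), monotone Boolean-sum /
union-program lower bounds, proof complexity of Frege (Frege.lean). What it does that prior routes
do not: every hub route on the Frege/EF axis (FeasibleWitnessing, ProofCplx) attacks superPOLYNOMIAL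
EF SIZE directly; this is the only line attacking the LINE-COUNT axis, one logarithm above the
30-year record (Buss1995 Thm 5: k ≥ c|A|), strictly underneath the shared item EFLowerBound; the
negatives index (6 PneNP entries, 2026-08-17: SymmetryBudget.WindowBarrier,
LyapunovRefutations.PathCompletePHPLowerBound, BavardGap.PlantedGenusPseudorandom,
Circuit.MagnificationFrontier, ORIncompressibility.NoTC0CompressionSAT, TwoTones.FrustrationGap)
touches none of its objects (the Lyapunov PHP item is about certificate DEGREE growth for pigeonhole
CNFs, another system and measure).

RANKED CRUXES. #0 FregeLinesSuperlinear (target) — No Frege system is linearly bounded in lines: for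
every Frege system F (sound, implicationally complete finite rule list over the tree's De Morgan
PropForm ℕ) there is no constant C such that every tautology φ has an F-proof with at most C·|φ|
lines. The rung T of the EF ladder; proved from X1 and X2 inside `closes` (seam P1) and the
antecedent of the residual R1. (why it might fail: It may be FALSE: "consistent with present
knowledge that all tautologies have O(n)-line Frege proofs" (BonetBuss1993 p.8, Buss1995 p.9); a
linear-line normal form for Frege would refute T and retire the EF ladder at its first rung.)
[BonetBuss1993, Buss1995, Krajicek1995, Pudlak2008, KrajicekProofComplexity2019]
#2 ACRearrangementLowerBound (crux) — CONJECTURE AC-1 (weakest T-sufficient form): there is a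
constant C such that for all large n some permutation π of Fin (n + 1) has (n + 1)·log₂(n + 1) ≤
C·U_AC(π), where U_AC(π) = `ACRewriting.acUniverse π` is the least cardinality of a subterm-closed
finite set Δ of AC-terms within which the AC calculus (comm / assoc / congruence instances with both
sides in Δ) derives x₀+(x₁+(⋯+x_n)) = x_{π 0}+(⋯+x_{π n}). Finite combinatorics of set-union
straight-line programs: decidable instance by instance, attained minimum (exists_card_eq_acUniverse,
landed), O(N log N) ceiling for every π by dyadic rebalancing. [difficulty: L] (why it might fail:
Sharing may win: the r×r transposition has U_AC < 48N despite Θ(N²) inversions (2001 Thm 7.4),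
reversal/rotations/separable recursions are O(N) and U_AC is subadditive; an O(N) or O(N log log N)
scheme for all π (Prop 7.6 when LIS or LDS is polylog) refutes X1.) [PudlakBuss1995, Krajicek1995,
arXiv:1912.02858, doi:10.1016/s0019-9958(83)80035-7]
#3 BAACBridge (crux) — BA-AC bridge (line-count form): for every Frege system F there is C_F such
that for all n, all permutations π of Fin (n + 1) and every F-proof p of the permutation-parity
tautology `PermutationParity.tauPerm π` (size 52(n+1)+16, gate chains for the parity of x in the
orders id and π) there is a subterm-closed universe Δ closing the AC rearrangement of π with |Δ| ≤
C_F·(proofLines p + (n + 1)): full Boolean reasoning cannot beat pure AC re-bracketing on this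
family by more than a constant factor plus linear slack. A simulation / normal-form statement with
no lower-bound content of its own; tools: Krajíček's generic-proof normal form
(KrajicekProofComplexity2019 Thm 2.5.3, L 2.5.7) and the valuation game (Krajicek1995 Thm 13.3.6).
[difficulty: L] (why it might fail: Boolean algebra is richer than AC: cancellation x⊕x=0 (Frege may
sweep the Tseitin graph G_π in any vertex order keeping only boundary parities), cuts on few
variables or distributive duplication could give O(N)-line proofs of tauPerm π for every π, refuting
X2 though not X1 or T.) [Krajicek1995, KrajicekProofComplexity2019, PudlakBuss1995, Tseitin1968]
#4 LinesToEFLadder (crux) — DECLARED RESIDUAL (summit-proxy strength; exempt from T3/T4; never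
staffed, never rendered as distance-to-summit): the rest of the EF ladder — if no Frege system is
linearly bounded in lines then extended Frege is not polynomially bounded over any Frege system
(consequent = verbatim the shared hub item EFLowerBound, stmt-PneNP-10743, = pnp.S32). From ω(N)
lines to N^{1+ε} lines needs a duplication/distributivity-charging mechanism (the AC method is
capped at N log N), and from there to superpolynomial EF size; it is the FRONTIER ledger's
bookkeeping edge exactly as ClimbToNPneCoNP is in route NtimeComplementLadder. [deps:
FregeLinesSuperlinear] [difficulty: open-problem] (why it might fail: Summit-proxy: EF (=
propositional S¹₂/PV) may be p-bounded even if Frege needs ω(n) lines; no mechanism climbs from N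
log N lines to superpolynomial size (A41 FeasibleInterpolationEF blocks the interpolation road for
EF). Residual, unstaffed.) [CookReckhow1979, KrajicekProofComplexity2019, Buss1995,
KrajicekPudlak1998]
#5 CollapseReachesEF (crux) — SHARED RESIDUAL (the existing item stmt-PneNP-17354 of
route-PneNP-FeasibleWitnessing, restated verbatim so that it re-attaches; attacked THERE, not here):
if P = NP (¬PneNP) then some Frege system has polynomially bounded extended Frege proofs —
Pich–Santhanam's W★ side ("any superpolynomial EF lower bound separates P and NP", via S¹₂-provable
uniform witnessing / anticheckers). [difficulty: open-problem] (why it might fail: Even the TRUTH of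
uniform witnessing is open (Pich–Santhanam JACM: "we do not yet know an unconditional answer"); P =
NP may hold via an algorithm lacking feasible correctness proofs (Cook–Krajíček 2007); any proof is
non-relativizing. Shared residual.) [doi:10.1145/3801091, arXiv:2312.08163,
doi:10.2178/jsl/1203350785, arXiv:2203.14379]

TWO-LAYER PLAN. Foreseen glued splits (nothing filed now): X1 ⇐ UpperCalibration → BiRunCharging →
X1 (UpperCalibration: acUniverse π ≤ c₁·N·(log₂N+1) for all π and acUniverse (transpose r) < 48 r² —
the tightness lemmas any invariant must survive; BiRunCharging: an invariant charging the nodes of Δ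
to the bi-run complexity of the leaf sets met along the forced walk, whp ≥ c·N·log N for random π).
X2 ⇐ GenericExtraction → ACSkeletonCollapse → X2 (GenericExtraction: a k-line F-proof of tauPerm π
has a most-general proof with O(k + N) distinct subformulas, Krajíček Thm 2.5.3 / L 2.5.7;
ACSkeletonCollapse: the ∧/∨/¬-structure of those subformulas over the parity gates collapses to
comm/assoc/cong instances between sub-sums at constant loss). ALTERNATIVE CUT if cancellation kills
X2 (documented, same assembly): the cancellative universe U_ACN ≤ U_AC (extra local identities t + t
~ 0, t + 0 ~ t) with X1ᴺ (stronger) / X2ᴺ (weaker) — a `--resplit`, not a new route.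

KILL CRITERIA. ¬X1 (an O(N) or O(N log log N) universe scheme for all π, e.g. extracted from a flat
exact census max_π U_AC(π)/N for N ≤ 8) ⇒ close `refuted:ACRearrangementLowerBound` (the AC road
cannot reach T; T survives as an item for other mechanisms). ¬X2 (an O(N)-line Frege schema for all
tauPerm π, or census evidence U_ACN ≪ U_AC) ⇒ pivot ONCE to the cancellative cut (X1ᴺ, X2ᴺ); if an
O(N)-line schema beats even U_ACN the family is dead for T and the route closes `refuted:BAACBridge`
(a non-linear family would be a NEW route). ¬T (a linear-line normal form for Frege) ⇒ the EF ladder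
is dead at rung 1: close this route AND flag EFLowerBound's routes (T is a consequence of EF-LB up
to the quadratic Statman simulation, so ¬T is summit-level negative knowledge). EFLowerBound proved
elsewhere moots X1/X2/T as a road (T then follows) but not as theorems.

NOT DECOMPOSED YET. Deliberately not decomposed at open: the explicit constant and scheme of the O(N
log N) upper calibration (dyadic rebalancing, four-block regroup, Lemmas 7.1–7.3′ of the 2001
folder), the transposition tightness theorem (Thm 7.4, < 48N), composition subadditivity and the
LIS/LDS bound (Prop 7.6) — all SUPPORT-level lemmas a prover attaches with `--supports
ACRearrangementLowerBound`; the ℓ-form and valuation-form strengthenings of X2; the decidability /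
certificate checker for `Derives` on a finite Δ (enables `decide` censuses); the Tseitin identity
¬tauPerm π = Ts(G_π). They become layer-2 children only after X1 or X2 moves.

CHEAPEST FALSIFIER. The EXACT U_AC census for all π ∈ S_N, N ≤ 8 (one kit job: nodes = ordered
splits of subsets, 3^N − 2^{N+1} + 1 of them, SAT/Datalog saturation for ~_Δ), reporting max_π
U_AC(π)/N against the structured permutations (transposition-like, rotations) and, side by side, the
cancellative U_ACN: a flat profile is strong evidence against X1; U_ACN ≪ U_AC signals the cut
switch for X2; an opening gap calibrates C. Run in-Lean by this seat for N = 3 and LANDED (p172699,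
`Literature.Computability.MetaComplexity.ACRewriting.acUniverse_finRotate_three` /
`acUniverse_one_three`): U_AC(3-cycle) = 8 > 7 = the floor forced by one comm + one assoc instance,
U_AC(id₃) = 5 = 2N − 1 — the gap opens at the first non-trivial N.

NUMBERS. |tauPerm π| = 52N + 16 exactly (landed `size_tauPerm`), 3N + 2 variables; subterm floor
U_AC(π) ≥ 2N − 1 (= for π = id); U_AC(π) = O(N log N) for every π (2001 folder (ii)); U_AC(transpose
r×r) < 48N with measured |Δ|/N = 5.00, 14.06, 19.14, 21.54 at r = 2, 4, 8, 16 (2001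
transpose_check); Frege record: k ≥ c|A| lines, Ω(|A|²)-type symbols (Buss1995 Thm 5/6); tree-like
Frege on ∧-permutation tautologies: ≥ ε·n·log n steps (PudlakBuss1995 Thm 2); ℓ_F(A) = O(k_F(A) +
|A|) (KrajicekProofComplexity2019 L 2.5.7); s_EF(A) = O(k_F(A) + |A|²) (ibid. Cor 2.4.7 as
constructed).

DEFINITION REQUESTS. None outstanding: the two notions Lean lacked were landed by this seat as T0
Literature definitions — `Literature.Computability.MetaComplexity.ACRewriting.{subterms,
SubtermClosed, Derives, Closes, Congruent, minUniverse, comb, combPerm, acUniverse}` with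
well-definedness theorems (p171945, Literature/Computability/MetaComplexity/ACRearrangement.lean)
and `Literature.Computability.MetaComplexity.PermutationParity.{xorVar, chain, tauPerm, lparity}`
with `isTautology_tauPerm`, `size_tauPerm` (p171948, PermutationParityTautologies.lean). Cite facts
worth filing later (none load-bearing): Krajicek1995 Thm 13.3.6 (n_τ vs ℓ_F),
KrajicekProofComplexity2019 L 2.5.7 / Cor 2.4.7, Buss1995 Thm 5, PudlakBuss1995 Thm 2 (needs
tree-like Frege proofs, not yet defined in the tree).

Novelty: Searches (2026-08-17, sketch seat + this seat; corpus = lit search fts/ --hybrid/vsearch, galaxy =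
lit galaxy search --star all): corpus "how to lie without being easily convicted lengths of proofs"
→ held paper:doi-10-1007-bfb0022253 (PudlakBuss1995, read pp.2–11: Prop 2, Thm 1, Thm 2 = Orevkov,
Prop 4); "Boolean valuations Frege extended Frege Krajicek" →
book:krajicek1995-bounded-arithmetic-propositional-logic-complexity-theory §13.3 pp.244–251; "Some
remarks on lengths of propositional proofs Buss" → paper:doi-10-1007-bf02391554 pp.7–10; --hybrid
"number of lines Frege proof permutation of conjunctions rearrangement linear" → Krajíček 2010
pp.108–110, Krajíček 2019 §2.4–2.5; --hybrid "deduction rule linear simulation Bonet Buss number of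
lines" → paper:doi-10-2307-2275228 pp.8–10; "Wilber binary search trees rotations lower bound
bit-reversal" → arxiv-1912.02858, arxiv-2110.12928; "Boolean sums monotone circuits lower bound
Wegener Mehlhorn" → doi-10-1016-0304-3975-89-90084-4, doi-10-1016-s0019-9958-83-80035-7; galaxy
(--star all) "number of lines in Frege|number of steps in Frege|number of proof steps", "Boolean
valuations|partial Boolean algebra", "Orevkov|permutation tautologies", "rotation distance|nearest
neighbor interchange", "Boolean sums|shifting graphs" → no relevant hits (LNCS front matter only:
panama:297005578453005, panama:276973850984472, panama:481869560807510); bm25 pdf "lower bound on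
the number of steps in Frege proofs permutation" → surveys only (galaxy  [refs: paper:doi-10-1007-bfb0022253, book:krajicek1995-bounded-arithmetic-propositional-logic-complexity-theory, paper:doi-10-1007-bf02391554, paper:doi-10-2307-2275228, arxiv-1912.02858, arxiv-2110.12928, doi-10-1016-0304-3975-89-90084-4, doi-10-1016-s0019-9958-83-80035-7, PudlakBuss1995, Krajicek1995]

Barriers (technique_class: frege-lines-lower-bounds, ac-universe, valuation-game): - technique_class: frege-lines-lower-bounds, ac-universe, valuation-game,
union-straight-line-programs, complexity-measures-on-proofs
- Literature.Barriers.PneNP.FeasibleInterpolationEF: outside its class — no interpolant is computed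
and `HasFeasibleInterpolationEF` is never a hypothesis; X1/X2/T live strictly below EF size; only
the residual R1's consequent (EF-LB) sits in the class the barrier constrains, and R1 is declared
residual, not attacked.
- Literature.Barriers.PneNP.NaturalProofs: outside — the barrier quantifies over constructive large
properties of Boolean FUNCTIONS useful against P/poly; X1 is a lower bound for ONE monotone
set-union task (the regime where superlinear and n^{3/2} bounds are theorems), X2/T are
proof-complexity statements; no property of a random function is used.
- Literature.Barriers.PneNP.Relativization: outside — no oracle-indifferent
simulation/diagonalization; the summit-level steps that relativize (R1, R2) are residuals.
- Literature.Barriers.PneNP.KhrapchenkoLimit: bites only the NAIVE De Morgan transcription of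
⊕-combs (quadratic size); evaded by the extension encoding — `size_tauPerm : |tauPerm π| = 52N + 16`
is landed.
- Literature.Barriers.PneNP.SubmodularMeasures: nearest in spirit (formal complexity measures cap at
O(n)); it quantifies over submodular FORMULA measures on Boolean functions, not over universes of
AC-terms; the lesson it shares with 2001 Cor 7.5 — an X1-invariant that only sees "Δ routes id-order
to π-order" caps at O(

History (route lifecycle, newest last):
- 2026-09-04T01:44:37Z · DORMANT — reconciler: no traction for 5 d (last activity statement-attached at 2026-08-30T01:11:25Z); parked, not closed — `ledger route dormant route-PneNP-FregeLinesACU (operator:999:1438399)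

sub-problem: PneNP · status: dormant · opened planner-type-1cdde557a6-0 2026-08-17T18:50:05Z · rev 0 · ledger route-PneNP-FregeLinesACUniverse
GENERATED by the gate from the ledger (D-0016/17). Provers cite these decls: `theorem foo : Summit.PneNP.PneNP.Theses.FregeLinesACUniverse.<Decl> := …` in Summits/PneNP/PneNP/Theorems/<Name>.lean.
-/

namespace Summit.PneNP.PneNP.Theses.FregeLinesACUniverse

open scoped BigOperators Topology Manifold Classical MeasureTheory ProbabilityTheory Matrix InnerProductSpace ComplexConjugate ContinuousMap
open Filter Set Function TopologicalSpace MeasureTheory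

attribute [summit_statement] _root_.PneNP

open Literature.PNP

/-- item stmt-PneNP-19640 · target · rank 0 · open · by planner
why it might fail: It may be FALSE: "consistent with present knowledge that all tautologies have O(n)-line Frege proofs" (BonetBuss1993 p.8, Buss1995 p.9); a linear-line normal form for Frege would refute T and retire the EF ladder at its first rung.
sources: BonetBuss1993, Buss1995, Krajicek1995, Pudlak2008, KrajicekProofComplexity2019
[target] No Frege system is linearly bounded in lines: for every Frege system F (sound,
implicationally complete finite rule list over the tree's De Morgan PropForm ℕ) there is no constant
C such that every tautology φ has an F-proof with at most C·|φ| lines. The rung T of the EF ladder;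
proved from X1 and X2 inside `closes` (seam P1) and the antecedent of the residual R1. -/
@[route_item "route-PneNP-FregeLinesACUniverse"]
def FregeLinesSuperlinear : Prop :=
  ∀ F : Literature.Computability.MetaComplexity.FregeSystem, Literature.Computability.MetaComplexity.IsFrege F → ¬ ∃ C : ℕ, ∀ φ : Literature.Computability.Complexity.PropForm ℕ, φ.IsTautology → ∃ p : List (Literature.Computability.Complexity.PropForm ℕ), F.IsProofOf p φ ∧ Literature.Computability.MetaComplexity.proofLines p ≤ C * φ.size

/-- item stmt-PneNP-19641 · crux · rank 2 · open · by planner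
why it might fail: Sharing may win: the r×r transposition has U_AC < 48N despite Θ(N²) inversions (2001 Thm 7.4), reversal/rotations/separable recursions are O(N) and U_AC is subadditive; an O(N) or O(N log log N) scheme for all π (Prop 7.6 when LIS or LDS is polylog) refutes X1.
sources: PudlakBuss1995, Krajicek1995, arXiv:1912.02858, doi:10.1016/s0019-9958(83)80035-7
[crux] CONJECTURE AC-1 (weakest T-sufficient form): there is a constant C such that for all large n
some permutation π of Fin (n + 1) has (n + 1)·log₂(n + 1) ≤ C·U_AC(π), where U_AC(π) =
`ACRewriting.acUniverse π` is the least cardinality of a subterm-closed finite set Δ of AC-terms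
within which the AC calculus (comm / assoc / congruence instances with both sides in Δ) derives
x₀+(x₁+(⋯+x_n)) = x_{π 0}+(⋯+x_{π n}). Finite combinatorics of set-union straight-line programs:
decidable instance by instance, attained minimum (exists_card_eq_acUniverse, landed), O(N log N)
ceiling for every π by dyadic rebalancing. [difficulty: L] -/
@[route_item "route-PneNP-FregeLinesACUniverse"]
def ACRearrangementLowerBound : Prop :=
  ∃ C : ℕ, ∀ᶠ n : ℕ in Filter.atTop, ∃ π : Equiv.Perm (Fin (n + 1)), (n + 1) * Nat.log 2 (n + 1) ≤ C * Literature.Computability.MetaComplexity.ACRewriting.acUniverse π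

/-- item stmt-PneNP-19642 · crux · rank 3 · open · by planner
why it might fail: Boolean algebra is richer than AC: cancellation x⊕x=0 (Frege may sweep the Tseitin graph G_π in any vertex order keeping only boundary parities), cuts on few variables or distributive duplication could give O(N)-line proofs of tauPerm π for every π, refuting X2 though not X1 or T.
sources: Krajicek1995, KrajicekProofComplexity2019, PudlakBuss1995, Tseitin1968
[crux] BA-AC bridge (line-count form): for every Frege system F there is C_F such that for all n,
all permutations π of Fin (n + 1) and every F-proof p of the permutation-parity tautology
`PermutationParity.tauPerm π` (size 52(n+1)+16, gate chains for the parity of x in the orders id and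
π) there is a subterm-closed universe Δ closing the AC rearrangement of π with |Δ| ≤ C_F·(proofLines
p + (n + 1)): full Boolean reasoning cannot beat pure AC re-bracketing on this family by more than a
constant factor plus linear slack. A simulation / normal-form statement with no lower-bound content
of its own; tools: Krajíček's generic-proof normal form (KrajicekProofComplexity2019 Thm 2.5.3, L
2.5.7) and the valuation game (Krajicek1995 Thm 13.3.6). [difficulty: L] -/
@[route_item "route-PneNP-FregeLinesACUniverse"]
def BAACBridge : Prop :=
  ∀ F : Literature.Computability.MetaComplexity.FregeSystem, Literature.Computability.MetaComplexity.IsFrege F → ∃ C : ℕ, ∀ (n : ℕ) (π : Equiv.Perm (Fin (n + 1))) (p : List (Literature.Computability.Complexity.PropForm ℕ)), F.IsProofOf p (Literature.Computability.MetaComplexity.PermutationParity.tauPerm π) → ∃ Δ : Finset (FreeAddMagma (Fin (n + 1))), Literature.Computability.MetaComplexity.ACRewriting.Closes Δ (Literature.Computability.MetaComplexity.ACRewriting.combPerm 1) (Literature.Computability.MetaComplexity.ACRewriting.combPerm π) ∧ Δ.card ≤ C * (Literature.Computability.MetaComplexity.proofLines p + (n + 1))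

/-- item stmt-PneNP-19643 · crux · rank 4 · open · by planner
why it might fail: Summit-proxy: EF (= propositional S¹₂/PV) may be p-bounded even if Frege needs ω(n) lines; no mechanism climbs from N log N lines to superpolynomial size (A41 FeasibleInterpolationEF blocks the interpolation road for EF). Residual, unstaffed.
sources: CookReckhow1979, KrajicekProofComplexity2019, Buss1995, KrajicekPudlak1998
[crux] DECLARED RESIDUAL (summit-proxy strength; exempt from T3/T4; never staffed, never rendered as
distance-to-summit): the rest of the EF ladder — if no Frege system is linearly bounded in lines
then extended Frege is not polynomially bounded over any Frege system (consequent = verbatim the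
shared hub item EFLowerBound, stmt-PneNP-10743, = pnp.S32). From ω(N) lines to N^{1+ε} lines needs a
duplication/distributivity-charging mechanism (the AC method is capped at N log N), and from there
to superpolynomial EF size; it is the FRONTIER ledger's bookkeeping edge exactly as ClimbToNPneCoNP
is in route NtimeComplementLadder. [deps: FregeLinesSuperlinear] [difficulty: open-problem] -/
@[route_item "route-PneNP-FregeLinesACUniverse"]
def LinesToEFLadder : Prop :=
  FregeLinesSuperlinear → ∀ F : Literature.Computability.MetaComplexity.FregeSystem, Literature.Computability.MetaComplexity.IsFrege F → ¬ F.IsEFPolyBounded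

/-- item stmt-PneNP-17354 · crux · rank 5 · open · by planner
why it might fail: Even the TRUTH of uniform witnessing is open (Pich–Santhanam JACM: "we do not yet know an unconditional answer"); P = NP may hold via an algorithm lacking feasible correctness proofs (Cook–Krajíček 2007); any proof is non-relativizing. Shared residual.
sources: doi:10.1145/3801091, arXiv:2312.08163, doi:10.2178/jsl/1203350785, arXiv:2203.14379
[crux] if P = NP (¬PneNP) then some — equivalently every — Frege system has polynomially bounded
extended Frege proofs: "any superpolynomial EF lower bound separates P and NP" (Pich–Santhanam Open
Problem 1), to be obtained from S¹₂-provable uniform witnessing of errors of n^k-time SAT algorithms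
(Cor. 20(2)) or APC₁-provable anticheckers (§1.3.1; KPS26 Condition 2). [difficulty: open-problem] -/
@[route_item "route-PneNP-FregeLinesACUniverse"]
def CollapseReachesEF : Prop :=
  ¬ PneNP → ∃ F : Literature.Computability.MetaComplexity.FregeSystem, Literature.Computability.MetaComplexity.IsFrege F ∧ F.IsEFPolyBounded

/-- item stmt-PneNP-19644 · assembly · rank 1 · open · by planner
sources: doi:10.1145/3801091, CookReckhow1979, PudlakBuss1995
[assembly] ACRearrangementLowerBound → BAACBridge → LinesToEFLadder → CollapseReachesEF → PneNP (T
is produced from the first two by the seam, EF-LB from T by R1, PneNP from EF-LB by R2). -/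
@[route_item "route-PneNP-FregeLinesACUniverse"]
def Assembly : Prop :=
  ACRearrangementLowerBound → BAACBridge → LinesToEFLadder → CollapseReachesEF → PneNP

/-! D-0027 §2.1 — DECIDING THEOREM (planner-authored via `route open/edit --closes-file`; by planner-type-1cdde557a6-0 2026-08-17T18:50:05Z):
its hypotheses are this route's items and its conclusion the sub-problem Statement (glue_lint), and it elaborates with this file. -/

@[closes "route-PneNP-FregeLinesACUniverse"] theorem closes (h₁ : ACRearrangementLowerBound) (h₂ : BAACBridge) (h₃ : LinesToEFLadder)
    (h₄ : CollapseReachesEF) : PneNP := by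
  -- seam P1 (proved here): the two attacked cruxes give superlinearly many LINES for the
  -- permutation-parity tautologies, i.e. the target `FregeLinesSuperlinear`.
  have seam : ACRearrangementLowerBound → BAACBridge → FregeLinesSuperlinear := by
    rintro ⟨C₁, hC₁⟩ hX2 G hG ⟨C₀, hC₀⟩
    obtain ⟨C₂, hC₂⟩ := hX2 G hG
    obtain ⟨N₀, hN₀⟩ := Filter.eventually_atTop.mp hC₁
    -- for every large n: log₂ (n + 1) ≤ K := C₁ C₂ (68 C₀ + 1)
    have key : ∀ n, N₀ ≤ n → Nat.log 2 (n + 1) ≤ C₁ * (C₂ * (68 * C₀ + 1)) := by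
      intro n hn
      obtain ⟨π, hπ⟩ := hN₀ n hn
      obtain ⟨p, hp, hlines⟩ :=
        hC₀ _ (Literature.Computability.MetaComplexity.PermutationParity.isTautology_tauPerm π)
      obtain ⟨Δ, hΔ, hcard⟩ := hC₂ n π p hp
      have hU := Literature.Computability.MetaComplexity.ACRewriting.acUniverse_le_card hΔ
      rw [Literature.Computability.MetaComplexity.PermutationParity.size_tauPerm] at hlines
      have h68 : Literature.Computability.MetaComplexity.proofLines p + (n + 1)
          ≤ (68 * C₀ + 1) * (n + 1) := by
        have : C₀ * (52 * (n + 1) + 16) ≤ C₀ * (68 * (n + 1)) :=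
          Nat.mul_le_mul_left _ (by omega)
        nlinarith
      have hchain : (n + 1) * Nat.log 2 (n + 1) ≤ (n + 1) * (C₁ * (C₂ * (68 * C₀ + 1))) :=
        calc (n + 1) * Nat.log 2 (n + 1)
            ≤ C₁ * Literature.Computability.MetaComplexity.ACRewriting.acUniverse π := hπ
          _ ≤ C₁ * Δ.card := Nat.mul_le_mul_left _ hU
          _ ≤ C₁ * (C₂ * (Literature.Computability.MetaComplexity.proofLines p + (n + 1))) :=
              Nat.mul_le_mul_left _ hcard
          _ ≤ C₁ * (C₂ * ((68 * C₀ + 1) * (n + 1))) :=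
              Nat.mul_le_mul_left _ (Nat.mul_le_mul_left _ h68)
          _ = (n + 1) * (C₁ * (C₂ * (68 * C₀ + 1))) := by ring
      exact Nat.le_of_mul_le_mul_left hchain (Nat.succ_pos n)
    -- evaluate at n + 1 = 2 ^ (N₀ + K + 1)
    set K := C₁ * (C₂ * (68 * C₀ + 1)) with hK
    have hpow : N₀ + K + 1 < 2 ^ (N₀ + K + 1) := Nat.lt_two_pow_self
    have h := key (2 ^ (N₀ + K + 1) - 1) (by omega)
    have hn : 2 ^ (N₀ + K + 1) - 1 + 1 = 2 ^ (N₀ + K + 1) := by omega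
    rw [hn, Nat.log_pow (by norm_num)] at h
    omega
  -- the frame (item `Assembly`): T from the seam, EF-LB from T by the residual R1, PneNP by R2
  have hA : Assembly := by
    intro hX1 hX2 hR1 hR2
    by_contra hS
    obtain ⟨F, hF, hEF⟩ := hR2 hS
    exact hR1 (seam hX1 hX2) F hF hEF
  exact hA h₁ h₂ h₃ h₄

end Summit.PneNP.PneNP.Theses.FregeLinesACUniverse
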